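import Mathlib
import HarnessLib
import Summits.HubbardSuperconductivity.HubbardSuperconductivity.Theorems.KLProgrammeKLRegimeSplitEdgeFactsTransfer

/-!
# Route `KLProgramme` — edge facts for the pair masses ACROSS TRANSFERS, V: the BAND LATTICE JETS — first and second DIFFERENCES OF THE FRAME BAND
# `e_K = ε_L − μ − K` at a torus step `Q`, in the currency `|p_Q|_𝕋 = klTorusNorm L Q` (the (D2)-deep input rows 18/19 consume)

Cell gate-hubbard-kl, seat hubbard-kl-k3c1-p1 (g21; child-1 lineage).  Rows 16/18/19 (`…SplitEdgeFactsBubbleTransferModulus`, `…RungSecondDiff`,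
`…CutoffSecondDiff`) reduce the transfer modulus of the ladder's pair masses to the three atoms `δ⁺e = e_K(p+Q) − e_K(p)`, `δ⁻e = e_K(p−Q) − e_K(p)`,
`δ²e = e_K(p+Q) − 2e_K(p) + e_K(p−Q)` of the frame band `e_K = nambuXiCT L μ K` (`= −2(cos p₁ + cos p₂) − μ − K(p)` at `p = 2πk⃗/L`, `K : TrigPolyC4v`).
THIS FILE bounds them, for EVERY frame and EVERY volume, by the torus sup-distance `s = |p_Q|_𝕋 = klTorusNorm L Q` of the step:
* §1 one dimension: `|cos(m(y+x)) − cos(my)| ≤ m·|x|_𝕋`; `cos(m(y+x)) − 2cos(my) + cos(m(y−x)) = −2(1 − cos(mx))·cos(my)`, `2(1 − cos(mx)) ≤ (m|x|_𝕋)²`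
  (periodicity first puts `x` in `(−π, π]`), hence `|δ²_x cos(m·)(y)| ≤ (m|x|_𝕋)²`;
* §2 discrete product rules; the symmetrised harmonics `h_{m,n}`: `|h(p+q) − h(p)| ≤ (m+n)·s`, `|h(p+q) − 2h(p) + h(p−q)| ≤ ((m+n)·s)²`;
* §3 frames: **`|K(p+q) − K(p)| ≤ coeffNorm 1 K · s`**, **`|K(p+q) − 2K(p) + K(p−q)| ≤ coeffNorm 2 K · s²`** (`coeffNorm r K = Σ (1+m+n)^r |κ_{m,n}|`);
* §4 the torus: `p_{k±Q} = p_k ± p_Q (mod 2πℤ²)` (`klbj_latticeMomentum_add_eq/_sub_eq`), so periodicity transports §1–§3 to `TorusSite 2 L`: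
  `|ε_L(k+Q) − ε_L(k)| ≤ 4s`, `|δ²_Q ε_L(k)| ≤ 4s²`, **`|e_K(k±Q) − e_K(k)| ≤ (4 + coeffNorm 1 K)·|p_Q|_𝕋`**, **`|e_K(k+Q) − 2e_K(k) + e_K(k−Q)| ≤ (4 + coeffNorm 2 K)·|p_Q|_𝕋²`**
  (`klbj_abs_nambuXiCT_add_sub_le`, `_sub_sub_le`, `_secondDiff_le`); admissible frames (`coeffNorm 2 K ≤ 16`): all constants `≤ 20`, uniformly in `L, μ`;
  in the pair class at resolution `n`, `|p_Q|_𝕋 ≤ 4^{-n}`.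
Reading for (D2)-deep: with `‖ĝ_K‖ ≲ 1/Λ_j`, `|e_K| ≲ Λ_j` on the scale-`j` supports every term of rows 18/19 is `O((|p_Q|_𝕋/Λ_j)²)·‖ĝ‖ = O((|Q|·4^j)²)·‖ĝ‖`;
what remains E1's is the shell sizes and the phase-space sums.  Everything is proved; no definitions; nothing asserts any slot, stub, K3 or SC. [folklore]
-/

noncomputable section

namespace Summit.HubbardSuperconductivity.HubbardSuperconductivity.Theorems.KLRegimeSplit

set_option linter.dupNamespace false -- summit = problem name (single-conjunct summit), D-0017

open Real Finset Literature.MathematicalPhysics.QuantumLattice Literature.Probability.LatticeModels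
open Summit.HubbardSuperconductivity.HubbardSuperconductivity.Theorems.KLProgrammeLegKernels

/-! ## §1 One dimension: differences of `y ↦ cos(m·y)` at a step `x`, modulo `2π` -/

/-- Every real is its representative in `(−π, π]` plus an integer multiple of `2π`, and `|x|_𝕋` is the size of the representative. [folklore] -/
theorem klbj_exists_rep (x : ℝ) : ∃ r : ℝ, ∃ k : ℤ, x = r + k * (2 * π) ∧ torusAbs x = |r| := by
  refine ⟨toIocMod Real.two_pi_pos (-π) x, toIocDiv Real.two_pi_pos (-π) x, ?_, rfl⟩
  have h := toIocMod_add_toIocDiv_zsmul Real.two_pi_pos (-π) x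
  rw [zsmul_eq_mul] at h; exact h.symm

/-- **First difference of a harmonic in one variable**: `|cos(m(y + x)) − cos(my)| ≤ m·|x|_𝕋`. [folklore] -/
theorem klbj_abs_cos_nat_mul_add_sub_le (m : ℕ) (y x : ℝ) :
    |Real.cos (m * (y + x)) - Real.cos (m * y)| ≤ m * torusAbs x := by
  obtain ⟨r, k, hr, habs⟩ := klbj_exists_rep x
  have heq : (m : ℝ) * (y + x) = m * (y + r) + ((m * k : ℤ) : ℝ) * (2 * π) := by rw [hr]; push_cast; ring
  rw [heq, Real.cos_add_int_mul_two_pi, habs]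
  calc |Real.cos (m * (y + r)) - Real.cos (m * y)| ≤ |m * (y + r) - m * y| := Real.abs_cos_sub_cos_le _ _
    _ = m * |r| := by rw [show (m : ℝ) * (y + r) - m * y = m * r by ring, abs_mul, Nat.abs_cast]

/-- **The second difference of a harmonic in one variable, exactly**: `cos(m(y+x)) − 2cos(my) + cos(m(y−x)) = −(2(1 − cos(mx)))·cos(my)`
(`= −4 sin²(mx/2)·cos(my)`). [folklore] -/
theorem klbj_cos_nat_mul_secondDiff_eq (m : ℕ) (y x : ℝ) :
    Real.cos (m * (y + x)) - 2 * Real.cos (m * y) + Real.cos (m * (y - x)) = -(2 * (1 - Real.cos (m * x))) * Real.cos (m * y) := by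
  simp only [mul_add, mul_sub, Real.cos_add, Real.cos_sub]
  ring

/-- `2(1 − cos(mx)) ≤ (m·|x|_𝕋)²` (`1 − cos t ≤ t²/2` at the representative of `x`). [folklore] -/
theorem klbj_two_mul_one_sub_cos_le (m : ℕ) (x : ℝ) : 2 * (1 - Real.cos (m * x)) ≤ (m * torusAbs x) ^ 2 := by
  obtain ⟨r, k, hr, habs⟩ := klbj_exists_rep x
  have heq : (m : ℝ) * x = m * r + ((m * k : ℤ) : ℝ) * (2 * π) := by rw [hr]; push_cast; ring
  rw [heq, Real.cos_add_int_mul_two_pi, habs, mul_pow, sq_abs, ← mul_pow]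
  have h := Real.one_sub_sq_div_two_le_cos (x := m * r)
  linarith

/-- **Second difference of a harmonic in one variable**: `|cos(m(y+x)) − 2cos(my) + cos(m(y−x))| ≤ (m·|x|_𝕋)²`. [folklore] -/
theorem klbj_abs_cos_nat_mul_secondDiff_le (m : ℕ) (y x : ℝ) :
    |Real.cos (m * (y + x)) - 2 * Real.cos (m * y) + Real.cos (m * (y - x))| ≤ (m * torusAbs x) ^ 2 := by
  rw [klbj_cos_nat_mul_secondDiff_eq, neg_mul, abs_neg, abs_mul]
  have h1 : 0 ≤ 2 * (1 - Real.cos (m * x)) := by have := Real.cos_le_one (m * x); linarith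
  rw [abs_of_nonneg h1]
  exact (mul_le_of_le_one_right h1 (Real.abs_cos_le_one _)).trans (klbj_two_mul_one_sub_cos_le m x)

/-! ## §2 Discrete product rules; the symmetrised harmonics `h_{m,n}` on `ℝ²` -/

/-- First-difference product rule with sizes: `|a₂ − a₁| ≤ A`, `|b₂ − b₁| ≤ B`, `|a₁|, |b₂| ≤ 1` ⟹ `|a₂b₂ − a₁b₁| ≤ A + B`. [folklore] -/
theorem klbj_abs_mul_sub_mul_le {a₁ a₂ b₁ b₂ A B : ℝ} (ha : |a₂ - a₁| ≤ A) (hb : |b₂ - b₁| ≤ B) (ha1 : |a₁| ≤ 1) (hb2 : |b₂| ≤ 1) :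
    |a₂ * b₂ - a₁ * b₁| ≤ A + B := by
  have hA : 0 ≤ A := (abs_nonneg _).trans ha
  rw [show a₂ * b₂ - a₁ * b₁ = (a₂ - a₁) * b₂ + a₁ * (b₂ - b₁) by ring]
  refine (abs_add_le _ _).trans ?_
  rw [abs_mul, abs_mul]
  have h1 : |a₂ - a₁| * |b₂| ≤ A * 1 := mul_le_mul ha hb2 (abs_nonneg _) hA
  have h2 : |a₁| * |b₂ - b₁| ≤ 1 * B := mul_le_mul ha1 hb (abs_nonneg _) zero_le_one
  linarith

/-- Second-difference product rule with sizes (`a₂b₂ − 2a₁b₁ + a₀b₀ = (δ²a)b₂ + 2(a₁ − a₀)(b₂ − b₁) + a₀(δ²b)`):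
`|δ²a| ≤ A²`, `|a₁ − a₀| ≤ A` (`A ≥ 0`), `|b₂ − b₁| ≤ B`, `|δ²b| ≤ B²`, `|a₀|, |b₂| ≤ 1` ⟹ `|a₂b₂ − 2a₁b₁ + a₀b₀| ≤ (A + B)²`. [folklore] -/
theorem klbj_abs_secondDiff_mul_le {a₀ a₁ a₂ b₀ b₁ b₂ A B : ℝ} (hA : 0 ≤ A) (ha2 : |a₂ - 2 * a₁ + a₀| ≤ A ^ 2)
    (ha1 : |a₁ - a₀| ≤ A) (hb1 : |b₂ - b₁| ≤ B) (hb2 : |b₂ - 2 * b₁ + b₀| ≤ B ^ 2) (ha : |a₀| ≤ 1) (hb : |b₂| ≤ 1) :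
    |a₂ * b₂ - 2 * (a₁ * b₁) + a₀ * b₀| ≤ (A + B) ^ 2 := by
  rw [show a₂ * b₂ - 2 * (a₁ * b₁) + a₀ * b₀ = (a₂ - 2 * a₁ + a₀) * b₂ + 2 * ((a₁ - a₀) * (b₂ - b₁)) + a₀ * (b₂ - 2 * b₁ + b₀) by ring]
  have e1 := abs_add_le ((a₂ - 2 * a₁ + a₀) * b₂ + 2 * ((a₁ - a₀) * (b₂ - b₁))) (a₀ * (b₂ - 2 * b₁ + b₀))
  have e2 := abs_add_le ((a₂ - 2 * a₁ + a₀) * b₂) (2 * ((a₁ - a₀) * (b₂ - b₁)))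
  have p1 : |(a₂ - 2 * a₁ + a₀) * b₂| = |a₂ - 2 * a₁ + a₀| * |b₂| := abs_mul _ _
  have p2 : |2 * ((a₁ - a₀) * (b₂ - b₁))| = 2 * (|a₁ - a₀| * |b₂ - b₁|) := by rw [abs_mul, abs_mul, abs_two]
  have p3 : |a₀ * (b₂ - 2 * b₁ + b₀)| = |a₀| * |b₂ - 2 * b₁ + b₀| := abs_mul _ _
  have h1 : |a₂ - 2 * a₁ + a₀| * |b₂| ≤ A ^ 2 * 1 := mul_le_mul ha2 hb (abs_nonneg _) (sq_nonneg _)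
  have h2 : |a₁ - a₀| * |b₂ - b₁| ≤ A * B := mul_le_mul ha1 hb1 (abs_nonneg _) hA
  have h3 : |a₀| * |b₂ - 2 * b₁ + b₀| ≤ 1 * B ^ 2 := mul_le_mul ha hb2 (abs_nonneg _) zero_le_one
  have hsq : (A + B) ^ 2 = A ^ 2 * 1 + 2 * (A * B) + 1 * B ^ 2 := by ring
  rw [hsq]
  linarith

/-- **First difference of a product harmonic**: `|cos(m(y₀+x₀))cos(n(y₁+x₁)) − cos(my₀)cos(ny₁)| ≤ m|x₀|_𝕋 + n|x₁|_𝕋`. [folklore] -/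
theorem klbj_abs_cosProd_add_sub_le (m n : ℕ) (y₀ y₁ x₀ x₁ : ℝ) :
    |Real.cos (m * (y₀ + x₀)) * Real.cos (n * (y₁ + x₁)) - Real.cos (m * y₀) * Real.cos (n * y₁)| ≤ m * torusAbs x₀ + n * torusAbs x₁ :=
  klbj_abs_mul_sub_mul_le (klbj_abs_cos_nat_mul_add_sub_le m y₀ x₀) (klbj_abs_cos_nat_mul_add_sub_le n y₁ x₁) (Real.abs_cos_le_one _)
    (Real.abs_cos_le_one _)

/-- **Second difference of a product harmonic**:
`|cos(m(y₀+x₀))cos(n(y₁+x₁)) − 2cos(my₀)cos(ny₁) + cos(m(y₀−x₀))cos(n(y₁−x₁))| ≤ (m|x₀|_𝕋 + n|x₁|_𝕋)²`. [folklore] -/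
theorem klbj_abs_cosProd_secondDiff_le (m n : ℕ) (y₀ y₁ x₀ x₁ : ℝ) :
    |Real.cos (m * (y₀ + x₀)) * Real.cos (n * (y₁ + x₁)) - 2 * (Real.cos (m * y₀) * Real.cos (n * y₁)) +
        Real.cos (m * (y₀ - x₀)) * Real.cos (n * (y₁ - x₁))| ≤ (m * torusAbs x₀ + n * torusAbs x₁) ^ 2 := by
  have ha1 : |Real.cos (m * y₀) - Real.cos (m * (y₀ - x₀))| ≤ m * torusAbs x₀ := by
    have h := klbj_abs_cos_nat_mul_add_sub_le m (y₀ - x₀) x₀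
    rwa [sub_add_cancel] at h
  exact klbj_abs_secondDiff_mul_le (mul_nonneg (Nat.cast_nonneg _) (klvc_torusAbs_nonneg _))
    (klbj_abs_cos_nat_mul_secondDiff_le m y₀ x₀) ha1
    (klbj_abs_cos_nat_mul_add_sub_le n y₁ x₁) (klbj_abs_cos_nat_mul_secondDiff_le n y₁ x₁) (Real.abs_cos_le_one _) (Real.abs_cos_le_one _)

/-- `|x_i|_𝕋 ≤ max(|x₀|_𝕋, |x₁|_𝕋) = torusSupNorm (x₀, x₁)` for `i = 0, 1`. [folklore] -/
theorem klbj_torusAbs_le_torusSupNorm (x : Fin 2 → ℝ) :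
    torusAbs (x 0) ≤ torusSupNorm (x 0, x 1) ∧ torusAbs (x 1) ≤ torusSupNorm (x 0, x 1) :=
  ⟨le_max_left _ _, le_max_right _ _⟩

/-- `m|x₀|_𝕋 + n|x₁|_𝕋 ≤ (m + n)·max(|x₀|_𝕋, |x₁|_𝕋)` and the same with `m, n` exchanged. [folklore] -/
theorem klbj_weighted_le_sum_mul_sup (m n : ℕ) (x : Fin 2 → ℝ) :
    m * torusAbs (x 0) + n * torusAbs (x 1) ≤ (m + n) * torusSupNorm (x 0, x 1) ∧
      n * torusAbs (x 0) + m * torusAbs (x 1) ≤ (m + n) * torusSupNorm (x 0, x 1) := by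
  obtain ⟨h0, h1⟩ := klbj_torusAbs_le_torusSupNorm x
  have hm : (0 : ℝ) ≤ m := Nat.cast_nonneg _; have hn : (0 : ℝ) ≤ n := Nat.cast_nonneg _
  constructor <;> nlinarith [mul_le_mul_of_nonneg_left h0 hm, mul_le_mul_of_nonneg_left h1 hn, mul_le_mul_of_nonneg_left h0 hn,
    mul_le_mul_of_nonneg_left h1 hm]

/-- **First difference of the symmetrised harmonic**: `|h_{m,n}(p + x) − h_{m,n}(p)| ≤ (m + n)·max(|x₀|_𝕋, |x₁|_𝕋)`. [folklore] -/
theorem klbj_abs_harmonic_add_sub_le (m n : ℕ) (p x : Fin 2 → ℝ) :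
    |TrigPolyC4v.harmonic m n (p + x) - TrigPolyC4v.harmonic m n p| ≤ (m + n) * torusSupNorm (x 0, x 1) := by
  obtain ⟨hw, hw'⟩ := klbj_weighted_le_sum_mul_sup m n x
  have d1 := (klbj_abs_cosProd_add_sub_le m n (p 0) (p 1) (x 0) (x 1)).trans hw
  have d2 := (klbj_abs_cosProd_add_sub_le n m (p 0) (p 1) (x 0) (x 1)).trans hw'
  simp only [TrigPolyC4v.harmonic, Pi.add_apply]
  rw [← sub_div, abs_div, abs_two, show Real.cos (m * (p 0 + x 0)) * Real.cos (n * (p 1 + x 1)) + Real.cos (n * (p 0 + x 0)) * Real.cos (m * (p 1 + x 1)) -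
      (Real.cos (m * p 0) * Real.cos (n * p 1) + Real.cos (n * p 0) * Real.cos (m * p 1)) =
      (Real.cos (m * (p 0 + x 0)) * Real.cos (n * (p 1 + x 1)) - Real.cos (m * p 0) * Real.cos (n * p 1)) +
        (Real.cos (n * (p 0 + x 0)) * Real.cos (m * (p 1 + x 1)) - Real.cos (n * p 0) * Real.cos (m * p 1)) by ring]
  rw [div_le_iff₀ (by norm_num : (0 : ℝ) < 2)]
  exact (abs_add_le _ _).trans (by linarith)

/-- **Second difference of the symmetrised harmonic**: `|h_{m,n}(p + x) − 2h_{m,n}(p) + h_{m,n}(p − x)| ≤ ((m + n)·max(|x₀|_𝕋, |x₁|_𝕋))²`. [folklore] -/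
theorem klbj_abs_harmonic_secondDiff_le (m n : ℕ) (p x : Fin 2 → ℝ) :
    |TrigPolyC4v.harmonic m n (p + x) - 2 * TrigPolyC4v.harmonic m n p + TrigPolyC4v.harmonic m n (p - x)| ≤
      ((m + n) * torusSupNorm (x 0, x 1)) ^ 2 := by
  obtain ⟨hw, hw'⟩ := klbj_weighted_le_sum_mul_sup m n x
  have hpos : 0 ≤ (m : ℝ) * torusAbs (x 0) + n * torusAbs (x 1) := by unfold torusAbs; positivity
  have hpos' : 0 ≤ (n : ℝ) * torusAbs (x 0) + m * torusAbs (x 1) := by unfold torusAbs; positivity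
  have d1 := (klbj_abs_cosProd_secondDiff_le m n (p 0) (p 1) (x 0) (x 1)).trans (pow_le_pow_left₀ hpos hw 2)
  have d2 := (klbj_abs_cosProd_secondDiff_le n m (p 0) (p 1) (x 0) (x 1)).trans (pow_le_pow_left₀ hpos' hw' 2)
  simp only [TrigPolyC4v.harmonic, Pi.add_apply, Pi.sub_apply]
  rw [show (Real.cos (m * (p 0 + x 0)) * Real.cos (n * (p 1 + x 1)) + Real.cos (n * (p 0 + x 0)) * Real.cos (m * (p 1 + x 1))) / 2 -
        2 * ((Real.cos (m * p 0) * Real.cos (n * p 1) + Real.cos (n * p 0) * Real.cos (m * p 1)) / 2) +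
        (Real.cos (m * (p 0 - x 0)) * Real.cos (n * (p 1 - x 1)) + Real.cos (n * (p 0 - x 0)) * Real.cos (m * (p 1 - x 1))) / 2 =
      ((Real.cos (m * (p 0 + x 0)) * Real.cos (n * (p 1 + x 1)) - 2 * (Real.cos (m * p 0) * Real.cos (n * p 1)) +
          Real.cos (m * (p 0 - x 0)) * Real.cos (n * (p 1 - x 1))) +
        (Real.cos (n * (p 0 + x 0)) * Real.cos (m * (p 1 + x 1)) - 2 * (Real.cos (n * p 0) * Real.cos (m * p 1)) +
          Real.cos (n * (p 0 - x 0)) * Real.cos (m * (p 1 - x 1)))) / 2 by ring,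
    abs_div, abs_two, div_le_iff₀ (by norm_num : (0 : ℝ) < 2)]
  exact (abs_add_le _ _).trans (by linarith)

/-! ## §3 Frames `K : TrigPolyC4v`: first and second differences against the coefficient weights `coeffNorm 1`, `coeffNorm 2` -/

/-- **First difference of a frame**: `|K(p + x) − K(p)| ≤ coeffNorm 1 K · max(|x₀|_𝕋, |x₁|_𝕋)`. [folklore] -/
theorem klbj_abs_eval_add_sub_le (K : TrigPolyC4v) (p x : Fin 2 → ℝ) :
    |K.eval (p + x) - K.eval p| ≤ K.coeffNorm 1 * torusSupNorm (x 0, x 1) := by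
  set s := torusSupNorm (x 0, x 1) with hs
  have hs0 : 0 ≤ s := torusSupNorm_nonneg _
  rw [TrigPolyC4v.eval, TrigPolyC4v.eval, ← sum_sub_distrib, TrigPolyC4v.coeffNorm, sum_mul]
  refine (abs_sum_le_sum_abs _ _).trans (sum_le_sum fun m _ => ?_)
  rw [← sum_sub_distrib, sum_mul]
  refine (abs_sum_le_sum_abs _ _).trans (sum_le_sum fun n _ => ?_)
  rw [← mul_sub, abs_mul, pow_one]
  calc |K.coeff m n| * |TrigPolyC4v.harmonic m n (p + x) - TrigPolyC4v.harmonic m n p|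
      ≤ |K.coeff m n| * ((m + n) * s) := mul_le_mul_of_nonneg_left (klbj_abs_harmonic_add_sub_le m n p x) (abs_nonneg _)
    _ ≤ |K.coeff m n| * ((1 + m + n) * s) := by
        refine mul_le_mul_of_nonneg_left (mul_le_mul_of_nonneg_right (by linarith) hs0) (abs_nonneg _)
    _ = (1 + m + n) * |K.coeff m n| * s := by ring

/-- **Second difference of a frame**: `|K(p + x) − 2K(p) + K(p − x)| ≤ coeffNorm 2 K · max(|x₀|_𝕋, |x₁|_𝕋)²`. [folklore] -/
theorem klbj_abs_eval_secondDiff_le (K : TrigPolyC4v) (p x : Fin 2 → ℝ) :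
    |K.eval (p + x) - 2 * K.eval p + K.eval (p - x)| ≤ K.coeffNorm 2 * torusSupNorm (x 0, x 1) ^ 2 := by
  set s := torusSupNorm (x 0, x 1) with hs
  have hs0 : 0 ≤ s := torusSupNorm_nonneg _
  have hexp : K.eval (p + x) - 2 * K.eval p + K.eval (p - x) =
      ∑ m ∈ range (K.degree + 1), ∑ n ∈ range (K.degree + 1),
        K.coeff m n * (TrigPolyC4v.harmonic m n (p + x) - 2 * TrigPolyC4v.harmonic m n p + TrigPolyC4v.harmonic m n (p - x)) := by
    simp only [TrigPolyC4v.eval, mul_sum, ← sum_sub_distrib, ← sum_add_distrib]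
    refine sum_congr rfl fun m _ => sum_congr rfl fun n _ => by ring
  rw [hexp, TrigPolyC4v.coeffNorm, sum_mul]
  refine (abs_sum_le_sum_abs _ _).trans (sum_le_sum fun m _ => ?_)
  rw [sum_mul]
  refine (abs_sum_le_sum_abs _ _).trans (sum_le_sum fun n _ => ?_)
  rw [abs_mul]
  have hmn : ((m : ℝ) + n) ^ 2 ≤ (1 + m + n) ^ 2 := pow_le_pow_left₀ (by positivity) (by linarith) 2
  calc |K.coeff m n| * |TrigPolyC4v.harmonic m n (p + x) - 2 * TrigPolyC4v.harmonic m n p + TrigPolyC4v.harmonic m n (p - x)|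
      ≤ |K.coeff m n| * (((m + n) * s) ^ 2) := mul_le_mul_of_nonneg_left (klbj_abs_harmonic_secondDiff_le m n p x) (abs_nonneg _)
    _ ≤ |K.coeff m n| * ((1 + m + n) ^ 2 * s ^ 2) := by
        rw [mul_pow]
        exact mul_le_mul_of_nonneg_left (mul_le_mul_of_nonneg_right hmn (sq_nonneg _)) (abs_nonneg _)
    _ = (1 + m + n) ^ 2 * |K.coeff m n| * s ^ 2 := by ring

/-! ## §4 The torus `(ℤ/Lℤ)²`: lattice momenta of `k⃗ ± Q` modulo `2πℤ²`, the bare band and the frame band -/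

section Torus

variable {L : ℕ} [NeZero L]

/-- **The lattice momentum of a sum**: `p_{k+Q} = p_k + p_Q + 2πz` with `z ∈ ℤ²` (the carry of the addition in `ℤ/Lℤ`). [folklore] -/
theorem klbj_latticeMomentum_add_eq (k Q : TorusSite 2 L) :
    ∃ z : Fin 2 → ℤ, latticeMomentum L (k + Q) = fun i => (latticeMomentum L k + latticeMomentum L Q) i + z i * (2 * π) := by
  have hL : (L : ℝ) ≠ 0 := by exact_mod_cast NeZero.ne L
  have hdvd : ∀ i : Fin 2, ∃ z : ℤ, ((((k + Q) i).val : ℕ) : ℤ) - ((((k i).val : ℕ) : ℤ) + (((Q i).val : ℕ) : ℤ)) = L * z := by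
    intro i
    have h0 : ((((((k + Q) i).val : ℕ) : ℤ) - ((((k i).val : ℕ) : ℤ) + (((Q i).val : ℕ) : ℤ)) : ℤ) : ZMod L) = 0 := by
      push_cast
      simp
    exact (ZMod.intCast_zmod_eq_zero_iff_dvd _ L).1 h0
  choose z hz using hdvd
  refine ⟨z, funext fun i => ?_⟩
  have hi : ((((k + Q) i).val : ℕ) : ℝ) = (((k i).val : ℕ) : ℝ) + (((Q i).val : ℕ) : ℝ) + (L : ℝ) * (z i : ℝ) := by
    have h' : (((((k + Q) i).val : ℕ) : ℤ) : ℝ) = (((((k i).val : ℕ) : ℤ) + (((Q i).val : ℕ) : ℤ) + L * z i : ℤ) : ℝ) := by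
      rw [← hz i]; push_cast; ring
    push_cast at h'
    exact h'
  simp only [Pi.add_apply] at hi
  simp only [latticeMomentum, Pi.add_apply, hi]
  field_simp

/-- **The lattice momentum of a difference**: `p_{k−Q} = p_k − p_Q + 2πz` with `z ∈ ℤ²`. [folklore] -/
theorem klbj_latticeMomentum_sub_eq (k Q : TorusSite 2 L) :
    ∃ z : Fin 2 → ℤ, latticeMomentum L (k - Q) = fun i => (latticeMomentum L k - latticeMomentum L Q) i + z i * (2 * π) := by
  obtain ⟨z, hz⟩ := klbj_latticeMomentum_add_eq (k - Q) Q
  rw [sub_add_cancel] at hz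
  refine ⟨fun i => -z i, funext fun i => ?_⟩
  have h := congrFun hz i
  simp only [Pi.add_apply, Pi.sub_apply] at h ⊢
  push_cast
  linarith

/-- Periodicity transport, sum: `K(p_{k+Q}) = K(p_k + p_Q)` and `h_{m,n}(p_{k+Q}) = h_{m,n}(p_k + p_Q)`. [folklore] -/
theorem klbj_eval_latticeMomentum_add (K : TrigPolyC4v) (k Q : TorusSite 2 L) :
    K.eval (latticeMomentum L (k + Q)) = K.eval (latticeMomentum L k + latticeMomentum L Q) := by
  obtain ⟨z, hz⟩ := klbj_latticeMomentum_add_eq k Q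
  rw [hz]; exact K.eval_periodic _ z

/-- Periodicity transport, difference: `K(p_{k−Q}) = K(p_k − p_Q)`. [folklore] -/
theorem klbj_eval_latticeMomentum_sub (K : TrigPolyC4v) (k Q : TorusSite 2 L) :
    K.eval (latticeMomentum L (k - Q)) = K.eval (latticeMomentum L k - latticeMomentum L Q) := by
  obtain ⟨z, hz⟩ := klbj_latticeMomentum_sub_eq k Q
  rw [hz]; exact K.eval_periodic _ z

/-- Periodicity transport for the band's cosines: `cos(p_{k+Q,i}) = cos(p_{k,i} + p_{Q,i})`, `cos(p_{k−Q,i}) = cos(p_{k,i} − p_{Q,i})`. [folklore] -/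
theorem klbj_cos_latticeMomentum_add_sub (k Q : TorusSite 2 L) (i : Fin 2) :
    Real.cos (latticeMomentum L (k + Q) i) = Real.cos (latticeMomentum L k i + latticeMomentum L Q i) ∧
      Real.cos (latticeMomentum L (k - Q) i) = Real.cos (latticeMomentum L k i - latticeMomentum L Q i) := by
  obtain ⟨z, hz⟩ := klbj_latticeMomentum_add_eq k Q
  obtain ⟨z', hz'⟩ := klbj_latticeMomentum_sub_eq k Q
  exact ⟨by rw [hz]; exact Real.cos_add_int_mul_two_pi _ _, by rw [hz']; exact Real.cos_add_int_mul_two_pi _ _⟩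

omit [NeZero L] in
/-- In the pair class at resolution `n` the step is small: `IsPairClassAt L Q n → |p_Q|_𝕋 ≤ 4^{-n}`. [folklore] -/
theorem klbj_klTorusNorm_le_of_isPairClassAt {Q : TorusSite 2 L} {n : ℕ} (h : IsPairClassAt L Q n) : klTorusNorm L Q ≤ ((4 : ℝ) ^ n)⁻¹ := h

/-- **First difference of the bare band**: `|ε_L(k+Q) − ε_L(k)| ≤ 4·|p_Q|_𝕋` (`ε_L = −2(cos p₁ + cos p₂)`). [folklore] -/
theorem klbj_abs_torusBand_add_sub_le (k Q : TorusSite 2 L) : |torusBand L (k + Q) - torusBand L k| ≤ 4 * klTorusNorm L Q := by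
  have hcos : ∀ i : Fin 2, |Real.cos (latticeMomentum L (k + Q) i) - Real.cos (latticeMomentum L k i)| ≤ klTorusNorm L Q := by
    intro i
    rw [(klbj_cos_latticeMomentum_add_sub k Q i).1]
    have h := klbj_abs_cos_nat_mul_add_sub_le 1 (latticeMomentum L k i) (latticeMomentum L Q i)
    simp only [Nat.cast_one, one_mul] at h
    refine h.trans ?_
    fin_cases i
    · exact (klbj_torusAbs_le_torusSupNorm (latticeMomentum L Q)).1
    · exact (klbj_torusAbs_le_torusSupNorm (latticeMomentum L Q)).2
  have hdiff : torusBand L (k + Q) - torusBand L k = -2 * ∑ i, (Real.cos (latticeMomentum L (k + Q) i) - Real.cos (latticeMomentum L k i)) := by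
    simp only [torusBand]; rw [Finset.sum_sub_distrib]; ring
  rw [hdiff, abs_mul, abs_neg, abs_two, Fin.sum_univ_two]
  linarith [hcos 0, hcos 1, abs_add_le (Real.cos (latticeMomentum L (k + Q) 0) - Real.cos (latticeMomentum L k 0))
    (Real.cos (latticeMomentum L (k + Q) 1) - Real.cos (latticeMomentum L k 1))]

/-- **Second difference of the bare band**: `|ε_L(k+Q) − 2ε_L(k) + ε_L(k−Q)| ≤ 4·|p_Q|_𝕋²`. [folklore] -/
theorem klbj_abs_torusBand_secondDiff_le (k Q : TorusSite 2 L) :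
    |torusBand L (k + Q) - 2 * torusBand L k + torusBand L (k - Q)| ≤ 4 * klTorusNorm L Q ^ 2 := by
  have hcos : ∀ i : Fin 2, |Real.cos (latticeMomentum L (k + Q) i) - 2 * Real.cos (latticeMomentum L k i) + Real.cos (latticeMomentum L (k - Q) i)| ≤
      klTorusNorm L Q ^ 2 := by
    intro i
    rw [(klbj_cos_latticeMomentum_add_sub k Q i).1, (klbj_cos_latticeMomentum_add_sub k Q i).2]
    have h := klbj_abs_cos_nat_mul_secondDiff_le 1 (latticeMomentum L k i) (latticeMomentum L Q i)
    simp only [Nat.cast_one, one_mul] at h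
    refine h.trans (pow_le_pow_left₀ (klvc_torusAbs_nonneg _) ?_ 2)
    fin_cases i
    · exact (klbj_torusAbs_le_torusSupNorm (latticeMomentum L Q)).1
    · exact (klbj_torusAbs_le_torusSupNorm (latticeMomentum L Q)).2
  have hdiff : torusBand L (k + Q) - 2 * torusBand L k + torusBand L (k - Q) =
      -2 * ∑ i, (Real.cos (latticeMomentum L (k + Q) i) - 2 * Real.cos (latticeMomentum L k i) + Real.cos (latticeMomentum L (k - Q) i)) := by
    simp only [torusBand, Fin.sum_univ_two]; ring
  rw [hdiff, abs_mul, abs_neg, abs_two, Fin.sum_univ_two]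
  linarith [hcos 0, hcos 1,
    abs_add_le (Real.cos (latticeMomentum L (k + Q) 0) - 2 * Real.cos (latticeMomentum L k 0) + Real.cos (latticeMomentum L (k - Q) 0))
      (Real.cos (latticeMomentum L (k + Q) 1) - 2 * Real.cos (latticeMomentum L k 1) + Real.cos (latticeMomentum L (k - Q) 1))]

/-- **BAND LATTICE JET, first order (forward)**: `|e_K(k+Q) − e_K(k)| ≤ (4 + coeffNorm 1 K)·|p_Q|_𝕋` for every frame `K`, every `L`, every `μ`. [folklore] -/
theorem klbj_abs_nambuXiCT_add_sub_le (μ : ℝ) (K : TrigPolyC4v) (k Q : TorusSite 2 L) :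
    |nambuXiCT L μ K (k + Q) - nambuXiCT L μ K k| ≤ (4 + K.coeffNorm 1) * klTorusNorm L Q := by
  have hK : |K.eval (latticeMomentum L (k + Q)) - K.eval (latticeMomentum L k)| ≤ K.coeffNorm 1 * klTorusNorm L Q := by
    rw [klbj_eval_latticeMomentum_add]; exact klbj_abs_eval_add_sub_le K (latticeMomentum L k) (latticeMomentum L Q)
  have hb := klbj_abs_torusBand_add_sub_le k Q
  rw [show nambuXiCT L μ K (k + Q) - nambuXiCT L μ K k =
      (torusBand L (k + Q) - torusBand L k) - (K.eval (latticeMomentum L (k + Q)) - K.eval (latticeMomentum L k)) by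
    simp only [nambuXiCT]; ring]
  exact (abs_sub _ _).trans (by linarith)

/-- **BAND LATTICE JET, first order (backward)**: `|e_K(k−Q) − e_K(k)| ≤ (4 + coeffNorm 1 K)·|p_Q|_𝕋`. [folklore] -/
theorem klbj_abs_nambuXiCT_sub_sub_le (μ : ℝ) (K : TrigPolyC4v) (k Q : TorusSite 2 L) :
    |nambuXiCT L μ K (k - Q) - nambuXiCT L μ K k| ≤ (4 + K.coeffNorm 1) * klTorusNorm L Q := by
  have h := klbj_abs_nambuXiCT_add_sub_le μ K (k - Q) Q
  rwa [sub_add_cancel, abs_sub_comm] at h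

/-- **BAND LATTICE JET, second order**: `|e_K(k+Q) − 2e_K(k) + e_K(k−Q)| ≤ (4 + coeffNorm 2 K)·|p_Q|_𝕋²` for every frame `K`, every `L`, every `μ`.
[folklore] -/
theorem klbj_abs_nambuXiCT_secondDiff_le (μ : ℝ) (K : TrigPolyC4v) (k Q : TorusSite 2 L) :
    |nambuXiCT L μ K (k + Q) - 2 * nambuXiCT L μ K k + nambuXiCT L μ K (k - Q)| ≤ (4 + K.coeffNorm 2) * klTorusNorm L Q ^ 2 := by
  have hK : |K.eval (latticeMomentum L (k + Q)) - 2 * K.eval (latticeMomentum L k) + K.eval (latticeMomentum L (k - Q))| ≤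
      K.coeffNorm 2 * klTorusNorm L Q ^ 2 := by
    rw [klbj_eval_latticeMomentum_add, klbj_eval_latticeMomentum_sub]; exact klbj_abs_eval_secondDiff_le K (latticeMomentum L k) (latticeMomentum L Q)
  have hb := klbj_abs_torusBand_secondDiff_le k Q
  rw [show nambuXiCT L μ K (k + Q) - 2 * nambuXiCT L μ K k + nambuXiCT L μ K (k - Q) =
      (torusBand L (k + Q) - 2 * torusBand L k + torusBand L (k - Q)) -
        (K.eval (latticeMomentum L (k + Q)) - 2 * K.eval (latticeMomentum L k) + K.eval (latticeMomentum L (k - Q))) by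
    simp only [nambuXiCT]; ring]
  exact (abs_sub _ _).trans (by linarith)

/-- **Admissible frames**: `coeffNorm 2 K ≤ 16` ⟹ all three jets with the constant `20`:
`|δ⁺_Q e_K|, |δ⁻_Q e_K| ≤ 20·|p_Q|_𝕋` and `|δ²_Q e_K| ≤ 20·|p_Q|_𝕋²`, uniformly in `L` and `μ`. [folklore] -/
theorem klbj_nambuXiCT_jets_of_isAdmissibleFrame (μ : ℝ) {K : TrigPolyC4v} (hK : IsAdmissibleFrame K) (k Q : TorusSite 2 L) :
    |nambuXiCT L μ K (k + Q) - nambuXiCT L μ K k| ≤ 20 * klTorusNorm L Q ∧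
      |nambuXiCT L μ K (k - Q) - nambuXiCT L μ K k| ≤ 20 * klTorusNorm L Q ∧
        |nambuXiCT L μ K (k + Q) - 2 * nambuXiCT L μ K k + nambuXiCT L μ K (k - Q)| ≤ 20 * klTorusNorm L Q ^ 2 := by
  have h2 : K.coeffNorm 2 ≤ 16 := (isAdmissibleFrame_iff K).1 hK
  have h1 : K.coeffNorm 1 ≤ 16 := (TrigPolyC4v.coeffNorm_mono (by norm_num) K).trans h2
  have hs := EngineV8.klband_klTorusNorm_nonneg Q
  refine ⟨(klbj_abs_nambuXiCT_add_sub_le μ K k Q).trans ?_, (klbj_abs_nambuXiCT_sub_sub_le μ K k Q).trans ?_,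
    (klbj_abs_nambuXiCT_secondDiff_le μ K k Q).trans ?_⟩
  · exact mul_le_mul_of_nonneg_right (by linarith) hs
  · exact mul_le_mul_of_nonneg_right (by linarith) hs
  · exact mul_le_mul_of_nonneg_right (by linarith) (sq_nonneg _)

end Torus

end Summit.HubbardSuperconductivity.HubbardSuperconductivity.Theorems.KLRegimeSplit

end
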